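import Literature.AlgebraicGeometry.Motives.HodgeStructureAbelianTypePolarizable
import Literature.AlgebraicGeometry.Motives.HodgeStructureLifting
import Literature.AlgebraicGeometry.Motives.HodgeStructureSemisimple
import Literature.AlgebraicGeometry.Motives.HodgeStructureProofs
import Literature.AlgebraicGeometry.Motives.AbelianVarietyCohomologyExteriorH1
import HarnessLib

/-!
# A polarisation is a morphism of Hodge structures `H ⊗ H → ℚ(-n)`; `ℚ(-1)` is a quotient of `H¹(A) ⊗ H¹(A)`

Family `hodge`, layer `Literature/AlgebraicGeometry/Motives` (lane `lit-hodgefound`, Layer B node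
B3-17 / TRIBUNAL-B B15, Tate objects in André's `ℳ(𝒜b)` on the Hodge side). THEOREMS plus two
plumbing `def`s (a bilinear form as a `2`-multilinear map / as a linear form on `V^{⊗2}`, and the
morphism of Hodge structures it defines); no notion is defined, nothing unproved is asserted.

Sources read verbatim. P. Deligne, *Théorie de Hodge II* [DeligneHodgeII1971] (cite-only,
acq-00429), 2.1.15: a polarisation of a Hodge structure `H` of weight `n` is a morphism of Hodge
structures `H ⊗ H → ℚ(-n)` satisfying a positivity condition — in the tree, `Polarization` is
recorded by the two Hodge–Riemann relations on the bilinear form (`Motives/HodgeStructure`, after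
Voisin I §7.1.2), and the first relation `Q(Fᵖ, F^{n+1-p}) = 0` IS the statement that
`Q : H^{⊗2} → ℚ(-n)` respects the Hodge filtrations, proved here. Y. André, *Pour une théorie
inconditionnelle des motifs*, Publ. Math. IHÉS 83 (1996) [Andre1996Motifs] (held text
`paper:doi-10-1007-bf02698643`, PDF p. 27 L30–34), §6.1 (p. 30): `ℳ(𝒜b)_𝒱` "contient les objets
de Tate (`ℚ(-1)` est quotient de `𝔥(A)` [⊗] `𝔥(A)` si `dim A > 0`)" (the held OCR drops the
symbol between the two `𝔥(A)`; read `⊗`): on the Hodge side, for a complex abelian variety `A` of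
positive dimension a polarisation of `H¹(A(ℂ); ℚ)` (Riemann form; the tree's theorem
`smoothProjective_hodgeStructure_isPolarizable_holds`) is a SURJECTIVE morphism
`H¹(A)^{⊗2} → ℚ(-1)`, split by semisimplicity. C. Voisin, *Hodge Theory and Complex Algebraic
Geometry I* [VoisinHodgeI2002], §7.1.2 (Hodge–Riemann relations; polarised Hodge structures of
smooth projective varieties).

## What is proved

* `HodgeStructure.Polarization.tensorHom Q : (H.tensorPower 2).Hom (ℚ(-n))` — the bilinear form
  of a polarisation, as a linear form on `V^{⊗2}`, is a morphism of Hodge structures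
  `H^{⊗2} → ℚ(-n)` (Deligne, Hodge II, 2.1.15): `Fᵖ(H^{⊗2}) = Σ_{a+b ≥ p} Fᵃ ⊗ Fᵇ` is killed for
  `p > n` by the first Hodge–Riemann relation.
* `HodgeStructure.Polarization.form_ne_zero` — on a non-zero space a polarisation form is non-zero
  (second Hodge–Riemann relation on a non-zero `V^{p,q}`, which exists since the pieces span
  `V_ℂ`); hence `Polarization.tensorHom_surjective`: `H^{⊗2} → ℚ(-n)` is onto.
* `HodgeStructure.exists_surjective_hom_abelianTensor_two_tate` — **André's parenthesis**: for a
  complex abelian variety `A` with `0 < dim A` (Hodge symmetric model `M`), there is a surjective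
  morphism of Hodge structures `(H¹(A(ℂ); ℚ)^{⊗2})(0) → ℚ(-1)` admitting a section (a morphism
  `σ` with `π ∘ σ = id`; semisimplicity, the tree's `Hom.exists_section_of_surjective` with
  `isPolarizable_abelianTensor`) — `ℚ(-1)` is a quotient, indeed a direct summand, of
  `H¹(A) ⊗ H¹(A)`.
-/

noncomputable section

open scoped TensorProduct
open Literature.AlgebraicTopology.SingularHomology

universe u

namespace Literature.AlgebraicGeometry.Motives

namespace HodgeStructure

/-! ### A bilinear form as a linear form on the tensor square -/

section Bilin

variable {K : Type*} [CommRing K] {M : Type*} [AddCommGroup M] [Module K M]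

/-- A bilinear form `B` on `M` as a `2`-multilinear map `(m₀, m₁) ↦ B(m₀, m₁)` on `Fin 2 → M`
(plumbing for `PiTensorProduct.lift`). [cite: DeligneHodgeII1971, 1.1.12 and 2.1.15] -/
def multilinearOfBilin (B : M →ₗ[K] M →ₗ[K] K) : MultilinearMap K (fun _ : Fin 2 ↦ M) K where
  toFun f := B (f 0) (f 1)
  map_update_add' f i x y := by
    fin_cases i
    · simp
    · simp
  map_update_smul' f i c x := by
    fin_cases i
    · simp
    · simp

/-- `multilinearOfBilin B f = B (f 0) (f 1)`. [cite: DeligneHodgeII1971, 2.1.15] -/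
@[simp]
theorem multilinearOfBilin_apply (B : M →ₗ[K] M →ₗ[K] K) (f : Fin 2 → M) :
    multilinearOfBilin B f = B (f 0) (f 1) :=
  rfl

/-- A bilinear form `B` on `M` as a linear form on the tensor square `M^{⊗2}`,
`m₀ ⊗ m₁ ↦ B(m₀, m₁)`. [cite: DeligneHodgeII1971, 1.1.12 and 2.1.15] -/
def tensorTwoForm (B : M →ₗ[K] M →ₗ[K] K) : (⨂[K]^2 M) →ₗ[K] K :=
  PiTensorProduct.lift (multilinearOfBilin B)

/-- `tensorTwoForm B (m₀ ⊗ m₁) = B(m₀, m₁)`. [cite: DeligneHodgeII1971, 2.1.15] -/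
@[simp]
theorem tensorTwoForm_tprod (B : M →ₗ[K] M →ₗ[K] K) (f : Fin 2 → M) :
    tensorTwoForm B (PiTensorProduct.tprod K f) = B (f 0) (f 1) :=
  PiTensorProduct.lift.tprod _

end Bilin

variable {V : Type u} [AddCommGroup V] [Module ℚ V] {n : ℤ}

/-- The complexified tensor-square form, read through the comparison `piTensorBaseChange` and the
identification `ℂ ⊗_ℚ ℚ = ℂ`, is the tensor-square form of the complexified bilinear form (both
sides agree on `1 ⊗ (v₀ ⊗ v₁)`, which span). [cite: DeligneHodgeII1971, 1.1.12] -/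
theorem rid_tensorTwoForm_baseChange (B : LinearMap.BilinForm ℚ V) (X : ℂ ⊗[ℚ] ⨂[ℚ]^2 V) :
    TensorProduct.AlgebraTensorModule.rid ℚ ℂ ℂ ((tensorTwoForm B).baseChange ℂ X) =
      tensorTwoForm (B.baseChange ℂ) (piTensorBaseChange V (Fin 2) X) := by
  have hspan : Submodule.span ℂ (TensorProduct.mk ℚ ℂ (⨂[ℚ]^2 V) 1 ''
      Set.range (PiTensorProduct.tprod ℚ)) = ⊤ := by
    rw [← Submodule.baseChange_span, PiTensorProduct.span_tprod_eq_top, Submodule.baseChange_top]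
  have key : (TensorProduct.AlgebraTensorModule.rid ℚ ℂ ℂ).toLinearMap ∘ₗ
      (tensorTwoForm B).baseChange ℂ =
      tensorTwoForm (B.baseChange ℂ) ∘ₗ piTensorBaseChange V (Fin 2) := by
    refine LinearMap.ext_on hspan ?_
    rintro _ ⟨_, ⟨v, rfl⟩, rfl⟩
    simp only [LinearMap.coe_comp, Function.comp_apply, TensorProduct.mk_apply,
      LinearMap.baseChange_tmul, tensorTwoForm_tprod, LinearEquiv.coe_coe,
      piTensorBaseChange_tmul_tprod, one_smul, TensorProduct.AlgebraTensorModule.rid_tmul]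
    rw [ofRat_apply, ofRat_apply, LinearMap.BilinForm.baseChange_tmul, mul_one]
  exact LinearMap.congr_fun key X

section PolarizationHom

variable [HodgeTensorFacts.{u, u}]

/-- **A polarisation is a morphism of Hodge structures `H ⊗ H → ℚ(-n)`** (Deligne, Hodge II,
2.1.15): the tensor-square form `v₀ ⊗ v₁ ↦ Q(v₀, v₁)` of a polarisation `Q` of `H` (weight `n`)
maps `Fᵖ(H^{⊗2}) = Σ_{a+b ≥ p} Fᵃ ⊗ Fᵇ` (Hodge II, 1.1.12) into `Fᵖ ℚ(-n)`, which is everything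
for `p ≤ n` and zero for `p > n` — the latter by the first Hodge–Riemann relation
`Q(Fᵃ, F^{n+1-a}) = 0` (Voisin I, §7.1.2), since `b ≥ p - a ≥ n + 1 - a`. The weight `-2·(-n)` of
`ℚ(-n)` is transported to `2 n`. [cite: DeligneHodgeII1971, 2.1.15 and 1.1.12]
[cite: VoisinHodgeI2002, §7.1.2] -/
def Polarization.tensorHom {H : HodgeStructure V n} (Q : H.Polarization) :
    (H.tensorPower 2).Hom ((HodgeStructure.tate (-n)).cast (by push_cast; ring)) where
  toLinearMap := tensorTwoForm Q.form
  map_F_le p := by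
    by_cases hp : p ≤ n
    · rw [cast_F, tate_F, pureFiltration_of_le (show p ≤ -(-n) by omega)]
      exact le_top
    · rw [cast_F, tate_F, pureFiltration_of_lt (show -(-n) < p by omega),
        Submodule.map_le_iff_le_comap, Submodule.comap_bot, tensorPower_F]
      refine iSup_le fun a ↦ iSup_le fun ha ↦ ?_
      rintro X ⟨Y, hY⟩
      rw [LinearMap.mem_ker]
      apply (TensorProduct.AlgebraTensorModule.rid ℚ ℂ ℂ).injective
      rw [map_zero, rid_tensorTwoForm_baseChange, ← hY]
      clear hY
      induction Y using PiTensorProduct.induction_on with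
      | smul_tprod c g =>
        rw [map_smul, map_smul, PiTensorProduct.mapIncl, PiTensorProduct.map_tprod,
          tensorTwoForm_tprod]
        have ha' : p ≤ a 0 + a 1 := by simpa [Fin.sum_univ_two] using ha
        have hb : H.F (a 1) ≤ H.F (n + 1 - a 0) := H.antitone_F (by omega)
        rw [Submodule.subtype_apply, Submodule.subtype_apply,
          Q.form_apply_eq_zero (a 0) _ (g 0).2 _ (hb (g 1).2), smul_zero]
      | add x y hx hy => rw [map_add, map_add, hx, hy, add_zero]

/-- The underlying linear map of `Q.tensorHom` is the tensor-square form of `Q`.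
[cite: DeligneHodgeII1971, 2.1.15] -/
@[simp]
theorem Polarization.tensorHom_toLinearMap {H : HodgeStructure V n} (Q : H.Polarization) :
    Q.tensorHom.toLinearMap = tensorTwoForm Q.form :=
  rfl

omit [HodgeTensorFacts.{u, u}] in
/-- **A polarisation form on a non-zero space is non-zero**: the Hodge pieces `V^{p,q}` span
`V_ℂ ≠ 0` (Deligne, Hodge II, 1.2.5; the tree's `iSup_piece_eq_top_holds`), so some piece has a
non-zero vector `x`, and the second Hodge–Riemann relation gives `Q_ℂ(x, x̄) ≠ 0` (Voisin I,
§7.1.2). [cite: VoisinHodgeI2002, §7.1.2] [cite: DeligneHodgeII1971, 1.2.5 and 2.1.15] -/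
theorem Polarization.form_ne_zero [Nontrivial V] {H : HodgeStructure V n} (Q : H.Polarization) :
    Q.form ≠ 0 := by
  intro h0
  -- a non-zero vector of `V_ℂ` and a piece not contained in `⊥`
  obtain ⟨v, hv⟩ := exists_ne (0 : V)
  have hVc : (ofRat v : ℂ ⊗[ℚ] V) ≠ 0 := fun h ↦ hv (ofRat_injective (by rw [h, map_zero]))
  have htop : (⨆ p : ℤ, H.piece p (n - p)) = ⊤ := iSup_piece_eq_top_holds H
  obtain ⟨p, hp⟩ : ∃ p : ℤ, H.piece p (n - p) ≠ ⊥ := by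
    by_contra hall
    push Not at hall
    have : (⊤ : Submodule ℂ (ℂ ⊗[ℚ] V)) = ⊥ := by
      rw [← htop]
      exact iSup_eq_bot.2 hall
    exact hVc (by simpa using (Submodule.eq_bot_iff _).1 this (ofRat v) Submodule.mem_top)
  obtain ⟨x, hx, hx0⟩ := (Submodule.ne_bot_iff _).1 hp
  obtain ⟨r, hr, hQ⟩ := Q.pos p (n - p) (by omega) x hx hx0
  rw [h0, LinearMap.BilinForm.baseChange_zero, LinearMap.zero_apply, LinearMap.zero_apply,
    mul_zero] at hQ
  exact hr.ne' (by exact_mod_cast hQ.symm)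

/-- **`Q : H^{⊗2} → ℚ(-n)` is surjective** for a polarisation `Q` of a Hodge structure on a
non-zero space (its form is non-zero, `Polarization.form_ne_zero`, and the target is a line).
[cite: DeligneHodgeII1971, 2.1.15] [cite: VoisinHodgeI2002, §7.1.2] -/
theorem Polarization.tensorHom_surjective [Nontrivial V] {H : HodgeStructure V n}
    (Q : H.Polarization) : Function.Surjective Q.tensorHom.toLinearMap := by
  -- some `Q(v, w) ≠ 0`
  obtain ⟨v, w, hvw⟩ : ∃ v w : V, Q.form v w ≠ 0 := by
    by_contra hall
    push Not at hall
    exact Q.form_ne_zero (LinearMap.ext fun v ↦ LinearMap.ext fun w ↦ by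
      rw [hall v w, LinearMap.zero_apply, LinearMap.zero_apply])
  intro q
  refine ⟨(q / Q.form v w) • PiTensorProduct.tprod ℚ ![v, w], ?_⟩
  rw [map_smul, Polarization.tensorHom_toLinearMap, tensorTwoForm_tprod]
  simp only [Matrix.cons_val_zero, Matrix.cons_val_one, smul_eq_mul]
  exact div_mul_cancel₀ q hvw

end PolarizationHom

/-! ### André's parenthesis: `ℚ(-1)` is a quotient of `H¹(A) ⊗ H¹(A)` for `dim A > 0` -/

section AbelianVariety

/-- **André, §6.1 (p. 30): "`ℚ(-1)` est quotient de `𝔥(A) ⊗ 𝔥(A)` si `dim A > 0`", on the Hodge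
side.** For a complex abelian variety `A` of positive dimension with Hodge symmetric model `M`,
there is a SURJECTIVE morphism of `ℚ`-Hodge structures `π : (H¹(A(ℂ); ℚ)^{⊗2})(0) → ℚ(-1)`
admitting a section `σ` (`π ∘ σ = id`): `π` is the tensor-square form of a polarisation of
`H¹(A)` (Riemann form; the tree's theorem `smoothProjective_hodgeStructure_isPolarizable_holds`;
`Polarization.tensorHom`, surjective by `Polarization.tensorHom_surjective` since
`dim_ℚ H¹(A(ℂ); ℚ) = 2 dim A > 0`), and `σ` exists because `(H¹(A)^{⊗2})(0)` is polarisable and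
finite-dimensional (`isPolarizable_abelianTensor`; semisimplicity, the tree's
`Hom.exists_section_of_surjective`). So the Tate structure `ℚ(-1)` is a quotient — indeed a
direct summand — of `H¹(A) ⊗ H¹(A)`. [cite: Andre1996Motifs, §6.1 (p. 30)]
[cite: DeligneHodgeII1971, 2.1.15] [cite: VoisinHodgeI2002, §7.1.2] -/
theorem exists_surjective_hom_abelianTensor_two_tate (A : AbelianVariety ℂ)
    (hA : IsSmoothProjective A.dim A.X) (M : HodgeTheory.HodgeModel A.dim A.X)
    (hM : M.IsHodgeSymmetric) (hdim : 0 < A.dim) :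
    ∃ (π : (abelianTensor A hA M hM 2 0).Hom ((tate (-1)).cast (by norm_num)))
      (σ : ((tate (-1)).cast (by norm_num : (-2 : ℤ) * -1 = (2 : ℕ) - 2 * 0)).Hom
        (abelianTensor A hA M hM 2 0)),
      Function.Surjective π.toLinearMap ∧ π.comp σ = Hom.id _ := by
  haveI := hodgeTensorFacts_holds.{0, 0}
  haveI : Module.Finite ℚ (singularCohomology ℚ ℚ (ComplexPoints A.X) 1) :=
    HodgeTheory.finiteDimensional_bettiCohomology hA 1
  -- `H¹(A(ℂ); ℚ) ≠ 0`: its dimension is `2 dim A > 0`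
  haveI : Nontrivial (singularCohomology ℚ ℚ (ComplexPoints A.X) 1) := by
    apply Module.nontrivial_of_finrank_pos (R := ℚ)
    have h1 : Module.finrank ℚ (singularCohomology ℚ ℚ (ComplexPoints A.X) 1) =
        Module.finrank ℂ (singularCohomology ℂ ℂ (ComplexPoints A.X) 1) := by
      rw [finrank_singularCohomology_eq_bettiNumber_of_field,
        finrank_singularCohomology_eq_bettiNumber_of_field, bettiNumber_eq_of_algebra ℚ ℂ]
    have h2 : Module.finrank ℂ (singularCohomology ℂ ℂ (ComplexPoints A.X) 1) = 2 * A.dim :=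
      AbelianVariety.finrank_complexBetti_one (A := A)
    rw [h1, h2]
    omega
  obtain ⟨Q⟩ : (M.hodgeStructure hA hM 1).IsPolarizable :=
    HodgeTheory.smoothProjective_hodgeStructure_isPolarizable_holds hA M hM 1
  -- `π := Q.tensorHom`, read on `abelianTensor A hA M hM 2 0 = ((H¹)^{⊗2}(0)).cast _`
  let π : (abelianTensor A hA M hM 2 0).Hom ((tate (-1)).cast (by norm_num)) :=
    ⟨Q.tensorHom.toLinearMap, fun p ↦ by
      have h := Q.tensorHom.map_F_le p
      simp only [cast_F, tensorPower_F, tate_F, neg_neg, Nat.cast_one] at h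
      simp only [cast_F, abelianTensor_F, add_zero, tate_F, neg_neg]
      exact h⟩
  have hπ : Function.Surjective π.toLinearMap := Q.tensorHom_surjective
  obtain ⟨σ, hσ⟩ := π.exists_section_of_surjective (isPolarizable_abelianTensor A hA M hM 2 0) hπ
  exact ⟨π, σ, hπ, hσ⟩

end AbelianVariety

end HodgeStructure

end Literature.AlgebraicGeometry.Motives

end
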